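import Literature.AlgebraicGeometry.HodgeTheory.DivisorLefschetzGroup
import Literature.AlgebraicGeometry.Milne1999.DivisorClassesSymmetricCentralizer
import HarnessLib

/-!
# «The algebra `B` does not depend on the choice of the polarization `λ`»: two Rosati involutions are
# conjugate by an invertible element of `S_λ` — Moonen–Zarhin 1998 §1, on the carrier (PROVED)

Layer `Literature/AlgebraicGeometry/HodgeTheory`; THEOREMS ONLY (no definition, no named fact; D-0026 net
debt 0). Sequel of `HodgeTheory/DivisorLefschetzGroup` (`S_λ ⊗ ℂ = symmetricPullbackSpan A h`, the
`Q_h`-self-adjoint part of `End⁰(X) ⊗ ℂ` on `H¹(A(ℂ); ℂ)`, and `B ⊗ ℂ = Algebra.adjoin ℂ (S_λ ⊗ ℂ)`), whose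
module docstring records «the print's «does not depend on the choice of `λ`» is not formalised»; here it is,
for the algebra `B` (for the group `G_div(X)` see `DivisorLefschetzGroupLargest`).

## The print

B. J. J. Moonen, Yu. G. Zarhin, *Weil classes on abelian varieties*, J. reine angew. Math. **496** (1998) =
arXiv:alg-geom/9612017 [MoonenZarhin1998WeilClasses], §1 (held chunk p0002 L53–L60), VERBATIM: «Choose a
polarization `λ` of `X`, and write `α ↦ α†` for the associated Rosati involution of `End⁰(X) ≅ M_m(D)`. Let
`S_λ ⊆ End⁰(X)` be the set of `†`-symmetric elements. We define the algebra `B ⊆ End⁰(X)` as the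
`ℚ`-subalgebra generated by `S_λ`. If `†′` is the Rosati involution associated to another polarization, then
`†′` is conjugated to `†` by an element of `S_λ`. It follows that the algebra `B` does not depend on the
choice of the polarization `λ`.»

(Lange–Birkenhake, *Complex Abelian Varieties*, Lemma 5.2.? / proof of Prop. 5.1.1 and Remark after
Thm. 5.2.4: for two polarizations `L₀, L` the Rosati involutions satisfy `f†′ = a⁻¹ f† a` with
`a = φ_{L₀}⁻¹ φ_L ∈ End⁰(X)` symmetric for `†`; Mumford §20–§21.)

## What is proved (carrier `V ⊗ ℂ = H¹(A(ℂ); ℂ)`, `End⁰(X) ⊗ ℂ` = the bicommutant `E''` of the `φ^*`)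

For a complex abelian variety `A` and two classes `h, h′ ∈ B¹(A) ⊗ ℂ = hodgeClassSpan (dim A) A.X 1` whose
polarization pairings `Q_h`, `Q_{h′}` are non-degenerate on `H¹(A(ℂ); ℂ)` (every pair of polarization
classes):

* **`exists_mem_symmetricPullbackSpan_conj`** — «`†′` is conjugated to `†` by an element of `S_λ`»: there are
  mutually inverse `a ∈ S_λ ⊗ ℂ`, `b ∈ S_{λ′} ⊗ ℂ ∩ S_λ ⊗ ℂ` (`a b = b a = 1`; `a` is the comparison
  endomorphism `Q_{h′}(x, y) ∝ Q_h(a x, y)`, i.e. `φ_λ⁻¹ φ_{λ′}` read on `H¹`) such that for every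
  endomorphism `T` of `H¹(A(ℂ); ℂ)` with a `Q_h`-adjoint `T†`, the conjugate `b T† a` is a `Q_{h′}`-adjoint of
  `T` (`T†′ = a⁻¹ T† a`), and **`mem_symmetricPullbackSpan_iff_mul_mem`**: `T ∈ S_{λ′} ⊗ ℂ ⟺ a T ∈ S_λ ⊗ ℂ`.
  Mechanism: `a = B♭⁻¹ ∘ B′♭` for the scalar symplectic forms `B = μ ∘ Q_h`, `B′ = μ′ ∘ Q_{h′}`; `a` is
  `B`-symmetric (both forms alternating), invertible (both non-degenerate), and commutes with the Hodge group
  (both forms are `Hg(A)(ℂ)`-invariant), hence lies in `E''` = the `ℂ`-span of the pull-backs (Deligne I 3.4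
  with Riemann's theorem, the tree's `Milne1999.mem_bicommutant_iff_mem_span`).
* **`adjoin_symmetricPullbackSpan_eq_of_mem_hodgeClassSpan`** — «the algebra `B` does not depend on the choice
  of the polarization»: `Algebra.adjoin ℂ (S_λ ⊗ ℂ) = Algebra.adjoin ℂ (S_{λ′} ⊗ ℂ)` as subalgebras of
  `End_ℂ H¹(A(ℂ); ℂ)` (`T ∈ S_{λ′} ⟹ T = b · (a T)` with `b, aT ∈ S_λ`, and symmetrically).
* **`adjoin_symmetricPullbackSpan_eq_of_isPolarization'`** — the same for `h, h′` rational of type `(1,1)` with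
  the hard Lefschetz property (`dim A ≥ 1`).
* Part 4 (rider) **`unitaryCentralizerGroup_eq_of_mem_hodgeClassSpan`** — Milne's group `S(A)(h)(ℂ)` does not
  depend on `h` either («the restriction of `†` to `C(A)` is independent of the choice of `D`», Milne §1 p. 643):
  `unitaryCentralizerGroup A h = unitaryCentralizerGroup A h′` for any two such classes, positive or not (the
  comparison endomorphism lies in `E''`, which `C(A)` centralizes) — the tree's
  `Milne1999.unitaryCentralizerGroup_eq_of_isKaehlerClass` without its Kähler hypotheses.

NOT here: Table 1 (`B`, `K_B` by Albert type); `B` as a `ℚ`-algebra (only `B ⊗ ℂ` lives on the carrier).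

## References

* [MoonenZarhin1998WeilClasses] B. J. J. Moonen, Yu. G. Zarhin, J. reine angew. Math. 496 (1998) =
  arXiv:alg-geom/9612017, §1 (chunk p0002 L53–L60: `S_λ`, `B`, «`†′` is conjugated to `†` by an element of
  `S_λ`», «`B` does not depend on the choice of the polarization `λ`»).
* [LangeBirkenhake1992] H. Lange, Ch. Birkenhake, *Complex Abelian Varieties*, §5.1 (Rosati involution =
  adjoint for the Riemann form, Prop. 5.1.1), §5.2 (Prop. 5.2.1, `NS_ℚ ≅ End^s`), Lemma 1.1.17.
* [MumfordAV1970] D. Mumford, *Abelian Varieties*, §20 (Riemann form, Rosati involution), §21 Application III.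
* [Milne1999LefschetzClasses] J. S. Milne, Duke Math. J. 96 (1999), §1 pp. 642–643 (`e_D`, `β ↦ β†`
  «independent of the choice of `D`» on `C(A)`, Remark 1.2).
* [Deligne1982HodgeCycles] P. Deligne, LNM 900 (1982), I §3 Prop. 3.4, §5 Prop. 5.1 (proof).

## Provenance

Lane `lit-hodgefound` (Track 2, Layer A), prover seat `lit-hodgefound-p21` (generation 14), row g14-#2.
-/

noncomputable section

open CategoryTheory
open Literature.AlgebraicTopology.SingularHomology
open Literature.AlgebraicGeometry.Motives
open Literature.AlgebraicGeometry.VanGeemen1994 (pullbackOne hodgeGroupOne mem_hodgeGroupOne_iff hodgeClassSpan)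
open Literature.AlgebraicGeometry.Milne1999 (centralizerAlgebra unitaryCentralizerGroup
  hodgeGroupOne_le_unitaryCentralizerGroup mem_bicommutant_iff_mem_span exists_bilinForm_isAlt_nondegenerate)
open Literature.Geometry.Kaehler (HasHardLefschetzProperty)

namespace Literature.AlgebraicGeometry.HodgeTheory

variable {A : AbelianVariety ℂ} {h h' : complexBetti A.X 2}

/-! ## Part 1. The comparison endomorphism `a = B♭⁻¹ ∘ B′♭` of two scalar forms on `H¹(A(ℂ); ℂ)` -/

section Comparison

variable {B B' : LinearMap.BilinForm ℂ (complexBetti A.X 1)} {a : Module.End ℂ (complexBetti A.X 1)}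

/-- **The comparison endomorphism of two bilinear forms**: for `B` non-degenerate and any `B′` on
`H¹(A(ℂ); ℂ)` there is `a` with `B(a x, y) = B′(x, y)` (`a = B♭⁻¹ ∘ B′♭`; for two Riemann forms this is
`φ_λ⁻¹ φ_{λ′}` read on `H¹`). [cite: LangeBirkenhake1992, §5.1 Prop. 5.1.1 and §5.2] -/
theorem exists_forall_bilin_apply_eq (hBnd : B.Nondegenerate) (B' : LinearMap.BilinForm ℂ (complexBetti A.X 1)) :
    ∃ a : Module.End ℂ (complexBetti A.X 1), ∀ x y : complexBetti A.X 1, B (a x) y = B' x y := by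
  haveI : Module.Finite ℂ (complexBetti A.X 1) := abelianVarietyCohomologyExteriorH1_holds.finite_one A
  refine ⟨(B.toDual hBnd).symm.toLinearMap ∘ₗ B', fun x y ↦ ?_⟩
  rw [← LinearMap.BilinForm.toDual_def hBnd, LinearMap.comp_apply, LinearEquiv.coe_toLinearMap,
    LinearEquiv.apply_symm_apply]

/-- The comparison endomorphism of two ALTERNATING forms is `B`-symmetric: `B(a x, y) = B(x, a y)`
(`φ_λ⁻¹ φ_{λ′}` is `†`-symmetric). [cite: LangeBirkenhake1992, §5.2 Prop. 5.2.1] [cite: MoonenZarhin1998WeilClasses, §1 (chunk p0002 L57–L59)] -/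
theorem bilin_apply_eq_bilin_apply_of_isAlt (hBalt : B.IsAlt) (hB'alt : B'.IsAlt)
    (ha : ∀ x y : complexBetti A.X 1, B (a x) y = B' x y) (x y : complexBetti A.X 1) :
    B (a x) y = B x (a y) := by
  rw [ha, ← hB'alt.neg_eq, ← ha, hBalt.neg_eq]

/-- The comparison endomorphism is injective when `B′` is non-degenerate. [cite: LangeBirkenhake1992, §5.1 Prop. 5.1.1] -/
theorem injective_of_forall_bilin_apply_eq (hB'nd : B'.Nondegenerate)
    (ha : ∀ x y : complexBetti A.X 1, B (a x) y = B' x y) : Function.Injective a := by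
  rw [← LinearMap.ker_eq_bot, LinearMap.ker_eq_bot']
  intro x hx
  refine hB'nd.1 x fun y ↦ ?_
  rw [← ha, hx, map_zero, LinearMap.zero_apply]

/-- **The comparison endomorphism commutes with every common isometry of `B` and `B′`**
(`B(a g x, y) = B′(g x, y) = B′(x, g⁻¹ y) = B(a x, g⁻¹ y) = B(g a x, y)`). [cite: LangeBirkenhake1992, §5.1 Prop. 5.1.1] -/
theorem apply_apply_eq_of_forall_bilin_apply_eq (hBnd : B.Nondegenerate)
    (ha : ∀ x y : complexBetti A.X 1, B (a x) y = B' x y) {g : complexBetti A.X 1 ≃ₗ[ℂ] complexBetti A.X 1}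
    (hgB : ∀ x y : complexBetti A.X 1, B (g x) (g y) = B x y)
    (hgB' : ∀ x y : complexBetti A.X 1, B' (g x) (g y) = B' x y) (x : complexBetti A.X 1) :
    a (g x) = g (a x) := by
  rw [← sub_eq_zero]
  refine hBnd.1 _ fun y ↦ ?_
  obtain ⟨y', rfl⟩ : ∃ y', y = g y' := ⟨g.symm y, (g.apply_symm_apply y).symm⟩
  rw [map_sub, LinearMap.sub_apply, sub_eq_zero, ha, hgB', hgB, ha]

/-- **The comparison endomorphism of two `Hg(A)(ℂ)`-invariant forms (`B` non-degenerate) lies in the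
bicommutant `E''` of the pull-backs** (`End⁰(X) ⊗ ℂ` acting): it commutes with the Hodge group, hence is a
`ℂ`-combination of pull-backs (Deligne I Prop. 3.4 with Riemann's theorem — the tree's
`Milne1999.mem_bicommutant_iff_mem_span` and `Deligne1982.mem_span_complexBetti_map_of_commute_hodgeGroup_of_riemann`).
(In print: `φ_λ⁻¹ φ_{λ′} ∈ End⁰(X)`.) [cite: MoonenZarhin1998WeilClasses, §1 (chunk p0002 L57–L59)]
[cite: Deligne1982HodgeCycles, I §3 Prop. 3.4 and §5 Prop. 5.1 (proof)] [cite: Milne1999LefschetzClasses, §1 Remark 1.2] -/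
theorem mem_bicommutant_of_forall_bilin_apply_eq (hBnd : B.Nondegenerate)
    (hBHg : ∀ g ∈ hodgeGroup A.dim A.X, ∀ v w : complexBetti A.X 1, B (g 1 v) (g 1 w) = B v w)
    (hB'Hg : ∀ g ∈ hodgeGroup A.dim A.X, ∀ v w : complexBetti A.X 1, B' (g 1 v) (g 1 w) = B' v w)
    (ha : ∀ x y : complexBetti A.X 1, B (a x) y = B' x y) :
    a ∈ Subalgebra.centralizer ℂ (centralizerAlgebra A : Set (Module.End ℂ (complexBetti A.X 1))) :=
  mem_bicommutant_iff_mem_span.2 (Deligne1982.mem_span_complexBetti_map_of_commute_hodgeGroup_of_riemann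
    deligneMilne1982_Thm_6_20_full_holds A a fun g hg x ↦
      apply_apply_eq_of_forall_bilin_apply_eq hBnd ha (hBHg g hg) (hB'Hg g hg) x)

/-- The two comparison endomorphisms are mutually inverse: `B(a x, y) = B′(x, y)` and `B′(b x, y) = B(x, y)`
give `a b = 1`. [cite: LangeBirkenhake1992, §5.1 Prop. 5.1.1] -/
theorem mul_eq_one_of_forall_bilin_apply_eq (hBnd : B.Nondegenerate) {b : Module.End ℂ (complexBetti A.X 1)}
    (ha : ∀ x y : complexBetti A.X 1, B (a x) y = B' x y) (hb : ∀ x y : complexBetti A.X 1, B' (b x) y = B x y) :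
    a * b = 1 := by
  refine LinearMap.ext fun x ↦ ?_
  rw [Module.End.mul_apply, Module.End.one_apply, ← sub_eq_zero]
  refine hBnd.1 _ fun y ↦ ?_
  rw [map_sub, LinearMap.sub_apply, ha, hb, sub_self]

end Comparison

/-! ## Part 2. `S_λ ⊗ ℂ` through a scalar form `B = μ ∘ Q_h` -/

section BilinForm

variable {B : LinearMap.BilinForm ℂ (complexBetti A.X 1)} {lam : complexBetti A.X (2 + 2 * (A.dim - 1)) →ₗ[ℂ] ℂ}

/-- `S_λ ⊗ ℂ` read through `B = μ ∘ Q_h` (`μ` injective): the `B`-symmetric elements of the bicommutant `E''`.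
[cite: MoonenZarhin1998WeilClasses, §1 (definition of S_λ; chunk p0002)] [cite: Milne1999LefschetzClasses, §1 Remark 1.2] -/
private theorem mem_symmetricPullbackSpan_iff_of_bilinForm' (hlam : Function.Injective lam)
    (hB : ∀ a c, B a c = lam (polarizationPairingOne A.X h (A.dim - 1) a c))
    {T : Module.End ℂ (complexBetti A.X 1)} :
    T ∈ symmetricPullbackSpan A h ↔
      T ∈ Subalgebra.centralizer ℂ (centralizerAlgebra A : Set (Module.End ℂ (complexBetti A.X 1))) ∧
        ∀ x y : complexBetti A.X 1, B (T x) y = B x (T y) := by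
  rw [mem_symmetricPullbackSpan_iff, mem_bicommutant_iff_mem_span]
  exact and_congr_right fun _ ↦
    ⟨fun H x y ↦ by rw [hB, hB, H], fun H x y ↦ hlam (by rw [← hB, ← hB, H])⟩

/-- `B = μ ∘ Q_h` is preserved by the Hodge group when `h ∈ B¹(A) ⊗ ℂ`. [cite: Milne1999LefschetzClasses, §4 Prop. 4.8 (p. 660)] -/
private theorem bilinForm_hodgeInvariant (hh : h ∈ hodgeClassSpan A.dim A.X 1)
    (hB : ∀ a c, B a c = lam (polarizationPairingOne A.X h (A.dim - 1) a c)) :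
    ∀ g ∈ hodgeGroup A.dim A.X, ∀ v w : complexBetti A.X 1, B (g 1 v) (g 1 w) = B v w := fun g hg v w ↦ by
  rw [hB, hB, (hodgeGroupOne_le_unitaryCentralizerGroup hh (mem_hodgeGroupOne_iff.2 ⟨g, hg, rfl⟩)).2 v w]

end BilinForm

/-! ## Part 3. «`†′` is conjugated to `†` by an element of `S_λ`» and «`B` does not depend on `λ`» -/

section Main

variable {B B' : LinearMap.BilinForm ℂ (complexBetti A.X 1)}
  {lam : complexBetti A.X (2 + 2 * (A.dim - 1)) →ₗ[ℂ] ℂ} {lam' : complexBetti A.X (2 + 2 * (A.dim - 1)) →ₗ[ℂ] ℂ}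
  {a : Module.End ℂ (complexBetti A.X 1)}

/-- **`T ∈ S_{λ′} ⊗ ℂ ⟺ a T ∈ S_λ ⊗ ℂ`** for the comparison endomorphism `a` of the scalar forms
`B = μ ∘ Q_h`, `B′ = μ′ ∘ Q_{h′}` (`h, h′ ∈ B¹(A) ⊗ ℂ`, both pairings non-degenerate): `B′(Tx, y) = B(aTx, y)` and
`B′(x, Ty) = B(ax, Ty) = B(x, aTy)` (`a` is `B`-symmetric), while `a, a⁻¹ ∈ E''`.
[cite: MoonenZarhin1998WeilClasses, §1 («†′ is conjugated to † by an element of S_λ»; chunk p0002 L57–L59)]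
[cite: LangeBirkenhake1992, §5.1 and §5.2] -/
theorem mem_symmetricPullbackSpan_iff_mul_mem (hh : h ∈ hodgeClassSpan A.dim A.X 1)
    (hh' : h' ∈ hodgeClassSpan A.dim A.X 1) (hBalt : B.IsAlt) (hBnd : B.Nondegenerate)
    (hlam : Function.Injective lam) (hB : ∀ x y, B x y = lam (polarizationPairingOne A.X h (A.dim - 1) x y))
    (hB'alt : B'.IsAlt) (hB'nd : B'.Nondegenerate) (hlam' : Function.Injective lam')
    (hB' : ∀ x y, B' x y = lam' (polarizationPairingOne A.X h' (A.dim - 1) x y))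
    (ha : ∀ x y : complexBetti A.X 1, B (a x) y = B' x y) {T : Module.End ℂ (complexBetti A.X 1)} :
    T ∈ symmetricPullbackSpan A h' ↔ a * T ∈ symmetricPullbackSpan A h := by
  have hBHg := bilinForm_hodgeInvariant hh hB
  have hB'Hg := bilinForm_hodgeInvariant hh' hB'
  have haE := mem_bicommutant_of_forall_bilin_apply_eq hBnd hBHg hB'Hg ha
  have hasym := bilin_apply_eq_bilin_apply_of_isAlt hBalt hB'alt ha
  -- the inverse comparison endomorphism `b`, `B′(b x, y) = B(x, y)`, `a b = b a = 1`, `b ∈ E''`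
  obtain ⟨b, hb⟩ := exists_forall_bilin_apply_eq hB'nd B
  have hbE := mem_bicommutant_of_forall_bilin_apply_eq hB'nd hB'Hg hBHg hb
  have hba : b * a = 1 := mul_eq_one_of_forall_bilin_apply_eq hB'nd hb ha
  rw [mem_symmetricPullbackSpan_iff_of_bilinForm' hlam' hB', mem_symmetricPullbackSpan_iff_of_bilinForm' hlam hB]
  refine ⟨fun ⟨hTE, hTsym⟩ ↦ ⟨Subalgebra.mul_mem _ haE hTE, fun x y ↦ ?_⟩, fun ⟨haTE, haTsym⟩ ↦ ⟨?_, fun x y ↦ ?_⟩⟩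
  · rw [Module.End.mul_apply, Module.End.mul_apply, ha, hTsym, ← ha, hasym]
  · have e : T = b * (a * T) := by rw [← mul_assoc, hba, one_mul]
    rw [e]
    exact Subalgebra.mul_mem _ hbE haTE
  · have e1 : B' (T x) y = B ((a * T) x) y := by rw [Module.End.mul_apply, ha]
    have e2 : B' x (T y) = B x ((a * T) y) := by rw [Module.End.mul_apply, ← hasym, ha]
    rw [e1, e2, haTsym]

/-- **«If `†′` is the Rosati involution associated to another polarization, then `†′` is conjugated to `†` by
an element of `S_λ`», PROVED on the carrier.** For `h, h′ ∈ B¹(A) ⊗ ℂ` with `Q_h`, `Q_{h′}` non-degenerate on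
`H¹(A(ℂ); ℂ)` there are `a ∈ S_λ ⊗ ℂ = symmetricPullbackSpan A h` and `b ∈ S_λ ⊗ ℂ ∩ S_{λ′} ⊗ ℂ` with
`a b = b a = 1` such that: (i) `T ∈ S_{λ′} ⊗ ℂ ⟺ a T ∈ S_λ ⊗ ℂ` for every endomorphism `T`; (ii) whenever `T†`
is a `Q_h`-adjoint of `T` (`Q_h(Tx, y) = Q_h(x, T†y)`), the conjugate `b T† a = a⁻¹ T† a` is a `Q_{h′}`-adjoint of
`T`. (`a = φ_λ⁻¹ φ_{λ′}` read on `H¹`: `Q_{h′} ∝ Q_h(a ·, ·)` up to the trivialisations of the top line.)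
[cite: MoonenZarhin1998WeilClasses, §1 (chunk p0002 L57–L59)] [cite: LangeBirkenhake1992, §5.1 Prop. 5.1.1 and §5.2]
[cite: MumfordAV1970, §20–§21] -/
theorem exists_mem_symmetricPullbackSpan_conj (hh : h ∈ hodgeClassSpan A.dim A.X 1)
    (hnd : ∀ x : complexBetti A.X 1, (∀ y, polarizationPairingOne A.X h (A.dim - 1) x y = 0) → x = 0)
    (hh' : h' ∈ hodgeClassSpan A.dim A.X 1)
    (hnd' : ∀ x : complexBetti A.X 1, (∀ y, polarizationPairingOne A.X h' (A.dim - 1) x y = 0) → x = 0) :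
    ∃ a ∈ symmetricPullbackSpan A h, ∃ b ∈ symmetricPullbackSpan A h,
      b ∈ symmetricPullbackSpan A h' ∧ a * b = 1 ∧ b * a = 1 ∧
      (∀ T : Module.End ℂ (complexBetti A.X 1), T ∈ symmetricPullbackSpan A h' ↔ a * T ∈ symmetricPullbackSpan A h) ∧
      ∀ T T' : Module.End ℂ (complexBetti A.X 1),
        (∀ x y : complexBetti A.X 1, polarizationPairingOne A.X h (A.dim - 1) (T x) y =
          polarizationPairingOne A.X h (A.dim - 1) x (T' y)) →
        ∀ x y : complexBetti A.X 1, polarizationPairingOne A.X h' (A.dim - 1) (T x) y =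
          polarizationPairingOne A.X h' (A.dim - 1) x ((b * T' * a) y) := by
  obtain ⟨B, hBalt, hBnd, lam, hlam, hB⟩ := exists_bilinForm_isAlt_nondegenerate (A := A) hnd
  obtain ⟨B', hB'alt, hB'nd, lam', hlam', hB'⟩ := exists_bilinForm_isAlt_nondegenerate (A := A) hnd'
  obtain ⟨a, ha⟩ := exists_forall_bilin_apply_eq hBnd B'
  obtain ⟨b, hb⟩ := exists_forall_bilin_apply_eq hB'nd B
  have hBHg := bilinForm_hodgeInvariant hh hB
  have hB'Hg := bilinForm_hodgeInvariant hh' hB'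
  have haE := mem_bicommutant_of_forall_bilin_apply_eq hBnd hBHg hB'Hg ha
  have hasym := bilin_apply_eq_bilin_apply_of_isAlt hBalt hB'alt ha
  have hab : a * b = 1 := mul_eq_one_of_forall_bilin_apply_eq hBnd ha hb
  have hba : b * a = 1 := mul_eq_one_of_forall_bilin_apply_eq hB'nd hb ha
  have key : ∀ T : Module.End ℂ (complexBetti A.X 1),
      T ∈ symmetricPullbackSpan A h' ↔ a * T ∈ symmetricPullbackSpan A h := fun T ↦
    mem_symmetricPullbackSpan_iff_mul_mem hh hh' hBalt hBnd hlam hB hB'alt hB'nd hlam' hB' ha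
  have key' : ∀ T : Module.End ℂ (complexBetti A.X 1),
      T ∈ symmetricPullbackSpan A h ↔ b * T ∈ symmetricPullbackSpan A h' := fun T ↦
    mem_symmetricPullbackSpan_iff_mul_mem hh' hh hB'alt hB'nd hlam' hB' hBalt hBnd hlam hB hb
  -- `a ∈ S_λ`: `a = a · 1` and `1 ∈ S_{λ′}`
  have h1' : (1 : Module.End ℂ (complexBetti A.X 1)) ∈ symmetricPullbackSpan A h' :=
    (mem_symmetricPullbackSpan_iff_of_bilinForm' hlam' hB').2 ⟨Subalgebra.one_mem _, fun _ _ ↦ rfl⟩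
  have h1 : (1 : Module.End ℂ (complexBetti A.X 1)) ∈ symmetricPullbackSpan A h :=
    (mem_symmetricPullbackSpan_iff_of_bilinForm' hlam hB).2 ⟨Subalgebra.one_mem _, fun _ _ ↦ rfl⟩
  have haS : a ∈ symmetricPullbackSpan A h := by simpa only [mul_one] using (key 1).1 h1'
  have hbS' : b ∈ symmetricPullbackSpan A h' := by simpa only [mul_one] using (key' 1).1 h1
  have hbE := mem_bicommutant_of_forall_bilin_apply_eq hB'nd hB'Hg hBHg hb
  -- `B(a x, b z) = B(x, z)`, so `b = a⁻¹` is `B`-symmetric as well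
  have habz : ∀ x z, B (a x) (b z) = B x z := fun x z ↦ by
    rw [hasym, ← Module.End.mul_apply, hab, Module.End.one_apply]
  have hbS : b ∈ symmetricPullbackSpan A h :=
    (mem_symmetricPullbackSpan_iff_of_bilinForm' hlam hB).2 ⟨hbE, fun x y ↦ by
      have e1 : B (b x) y = B (b x) (a (b y)) := by
        rw [← Module.End.mul_apply a b y, hab, Module.End.one_apply]
      rw [e1, ← hasym (b x) (b y)]
      change B ((a * b) x) (b y) = B x (b y)
      rw [hab, Module.End.one_apply]⟩
  refine ⟨a, haS, b, hbS, hbS', hab, hba, key, fun T T' hT' x y ↦ hlam' ?_⟩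
  -- (ii) `b T† a` is a `Q_{h′}`-adjoint of `T`: `B′(Tx, y) = B(Tx, a y) = B(x, T†a y) = B(a x, b T† a y)`
  have hT'B : ∀ x y, B (T x) y = B x (T' y) := fun x y ↦ by rw [hB, hB, hT']
  rw [← hB', ← hB', ← ha, hasym, hT'B, Module.End.mul_apply, Module.End.mul_apply, ← ha, habz]

/-- **«It follows that the algebra `B` does not depend on the choice of the polarization `λ`», PROVED on the
carrier**: for `h, h′ ∈ B¹(A) ⊗ ℂ` with non-degenerate polarization pairings on `H¹(A(ℂ); ℂ)`, the subalgebras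
of `End_ℂ H¹(A(ℂ); ℂ)` generated by `S_λ ⊗ ℂ` and by `S_{λ′} ⊗ ℂ` coincide (`T ∈ S_{λ′} ⟹ T = b · (aT)` with
`b, aT ∈ S_λ`, and symmetrically). [cite: MoonenZarhin1998WeilClasses, §1 («the algebra B does not depend on the choice of the polarization λ»; chunk p0002 L59–L60)]
[cite: LangeBirkenhake1992, §5.1 and §5.2] -/
theorem adjoin_symmetricPullbackSpan_eq_of_mem_hodgeClassSpan (hh : h ∈ hodgeClassSpan A.dim A.X 1)
    (hnd : ∀ x : complexBetti A.X 1, (∀ y, polarizationPairingOne A.X h (A.dim - 1) x y = 0) → x = 0)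
    (hh' : h' ∈ hodgeClassSpan A.dim A.X 1)
    (hnd' : ∀ x : complexBetti A.X 1, (∀ y, polarizationPairingOne A.X h' (A.dim - 1) x y = 0) → x = 0) :
    Algebra.adjoin ℂ (symmetricPullbackSpan A h : Set (Module.End ℂ (complexBetti A.X 1))) =
      Algebra.adjoin ℂ (symmetricPullbackSpan A h' : Set (Module.End ℂ (complexBetti A.X 1))) := by
  -- one inclusion from the conjugation data, for any ordered pair
  have incl : ∀ {k k' : complexBetti A.X 2}, k ∈ hodgeClassSpan A.dim A.X 1 →
      (∀ x : complexBetti A.X 1, (∀ y, polarizationPairingOne A.X k (A.dim - 1) x y = 0) → x = 0) →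
      k' ∈ hodgeClassSpan A.dim A.X 1 →
      (∀ x : complexBetti A.X 1, (∀ y, polarizationPairingOne A.X k' (A.dim - 1) x y = 0) → x = 0) →
      Algebra.adjoin ℂ (symmetricPullbackSpan A k' : Set (Module.End ℂ (complexBetti A.X 1))) ≤
        Algebra.adjoin ℂ (symmetricPullbackSpan A k : Set (Module.End ℂ (complexBetti A.X 1))) := by
    intro k k' hk hknd hk' hk'nd
    obtain ⟨a, -, b, hbS, -, -, hba, key, -⟩ := exists_mem_symmetricPullbackSpan_conj hk hknd hk' hk'nd
    refine Algebra.adjoin_le fun T hT ↦ ?_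
    have e : T = b * (a * T) := by rw [← mul_assoc, hba, one_mul]
    rw [e]
    exact Subalgebra.mul_mem _ (Algebra.subset_adjoin hbS) (Algebra.subset_adjoin ((key T).1 hT))
  exact le_antisymm (incl hh' hnd' hh hnd) (incl hh hnd hh' hnd')

/-- A rational `(1,1)`-class lies in `B¹(A) ⊗ ℂ`. [cite: VoisinHodgeI2002, §7.1.2 and §11.3.2] -/
private theorem mem_hodgeClassSpan_of_isRationalClass'' {k : complexBetti A.X 2} (hQ : IsRationalClass k)
    (h11 : IsOfHodgeType A.dim A.X 2 1 1 k) : k ∈ hodgeClassSpan A.dim A.X 1 :=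
  Submodule.subset_span
    (show k ∈ {c : complexBetti A.X (2 * 1) | IsRationalClass c ∧ IsOfHodgeType A.dim A.X (2 * 1) 1 1 c}
      from ⟨hQ, h11⟩)

/-- **«`B` does not depend on the choice of the polarization», for polarization classes** (`dim A ≥ 1`; `h`,
`h′` rational of type `(1,1)` with the hard Lefschetz property).
[cite: MoonenZarhin1998WeilClasses, §1 (chunk p0002 L59–L60)] [cite: VoisinHodgeI2002, §6.2.3 (hard Lefschetz)] -/
theorem adjoin_symmetricPullbackSpan_eq_of_isPolarization' (h1 : 1 ≤ A.dim) (hQ : IsRationalClass h)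
    (h11 : IsOfHodgeType A.dim A.X 2 1 1 h) (hHL : HasHardLefschetzProperty h A.dim) (hQ' : IsRationalClass h')
    (h11' : IsOfHodgeType A.dim A.X 2 1 1 h') (hHL' : HasHardLefschetzProperty h' A.dim) :
    Algebra.adjoin ℂ (symmetricPullbackSpan A h : Set (Module.End ℂ (complexBetti A.X 1))) =
      Algebra.adjoin ℂ (symmetricPullbackSpan A h' : Set (Module.End ℂ (complexBetti A.X 1))) :=
  adjoin_symmetricPullbackSpan_eq_of_mem_hodgeClassSpan (mem_hodgeClassSpan_of_isRationalClass'' hQ h11)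
    (fun _ hx ↦ Milne1999.eq_zero_of_forall_polarizationPairingOne_eq_zero_of_hasHardLefschetzProperty h1 hHL hx)
    (mem_hodgeClassSpan_of_isRationalClass'' hQ' h11')
    (fun _ hx ↦ Milne1999.eq_zero_of_forall_polarizationPairingOne_eq_zero_of_hasHardLefschetzProperty h1 hHL' hx)

/-- **`G_div(X)(ℂ)` centralizes `B ⊗ ℂ` for EVERY polarization**: for `h, h′` as above, an element of
`divisorLefschetzGroup A h` commutes with every element of `S_{λ′} ⊗ ℂ` as well.
[cite: MoonenZarhin1998WeilClasses, §1 (chunk p0002 L59–L60 and L64–L67)] -/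
theorem divisorLefschetzGroup_comm_of_mem_symmetricPullbackSpan (hh : h ∈ hodgeClassSpan A.dim A.X 1)
    (hnd : ∀ x : complexBetti A.X 1, (∀ y, polarizationPairingOne A.X h (A.dim - 1) x y = 0) → x = 0)
    (hh' : h' ∈ hodgeClassSpan A.dim A.X 1)
    (hnd' : ∀ x : complexBetti A.X 1, (∀ y, polarizationPairingOne A.X h' (A.dim - 1) x y = 0) → x = 0)
    {u : complexBetti A.X 1 ≃ₗ[ℂ] complexBetti A.X 1} (hu : u ∈ divisorLefschetzGroup A h)
    {T : Module.End ℂ (complexBetti A.X 1)} (hT : T ∈ symmetricPullbackSpan A h') (x : complexBetti A.X 1) :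
    u (T x) = T (u x) := by
  refine divisorLefschetzGroup_comm_of_mem_adjoin hu ?_ x
  rw [adjoin_symmetricPullbackSpan_eq_of_mem_hodgeClassSpan hh hnd hh' hnd']
  exact Algebra.subset_adjoin hT

end Main

/-! ## Part 4 (rider). Milne's `S(A)(h)(ℂ)` does not depend on the class `h ∈ B¹(A) ⊗ ℂ` either -/

section Milne

/-- **«the restriction of `†` to `C(A)` is independent of the choice of `D`» (Milne 1999 §1 p. 643), in group
form and for ANY two classes `h, h′ ∈ B¹(A) ⊗ ℂ` with non-degenerate polarization pairings**:
`unitaryCentralizerGroup A h = unitaryCentralizerGroup A h′` — an element of `C(A)^×` preserving `Q_h` preserves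
`Q_{h′}`, because the comparison endomorphism `a` (`B′(x, y) = B(a x, y)`, Part 1) lies in `E'' = C(C(A))`, which
`C(A)` centralizes: `B′(ux, uy) = B(a ux, uy) = B(u ax, uy) = B(ax, y) = B′(x, y)`. This removes the Kähler
(positivity) hypotheses of the tree's `Milne1999.unitaryCentralizerGroup_eq_of_isKaehlerClass` (there via Thm. 4.4):
any two non-degenerate classes of `B¹(A) ⊗ ℂ`, positive or not, give the same group `S(A)(ℂ)`.
[cite: Milne1999LefschetzClasses, §1 pp. 643–644] [cite: MoonenZarhin1998WeilClasses, §1 (chunk p0002 L57–L60)] -/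
theorem unitaryCentralizerGroup_eq_of_mem_hodgeClassSpan (hh : h ∈ hodgeClassSpan A.dim A.X 1)
    (hnd : ∀ x : complexBetti A.X 1, (∀ y, polarizationPairingOne A.X h (A.dim - 1) x y = 0) → x = 0)
    (hh' : h' ∈ hodgeClassSpan A.dim A.X 1)
    (hnd' : ∀ x : complexBetti A.X 1, (∀ y, polarizationPairingOne A.X h' (A.dim - 1) x y = 0) → x = 0) :
    unitaryCentralizerGroup A h = unitaryCentralizerGroup A h' := by
  -- one inclusion, for any ordered pair of classes
  have incl : ∀ {k k' : complexBetti A.X 2}, k ∈ hodgeClassSpan A.dim A.X 1 →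
      (∀ x : complexBetti A.X 1, (∀ y, polarizationPairingOne A.X k (A.dim - 1) x y = 0) → x = 0) →
      k' ∈ hodgeClassSpan A.dim A.X 1 →
      (∀ x : complexBetti A.X 1, (∀ y, polarizationPairingOne A.X k' (A.dim - 1) x y = 0) → x = 0) →
      unitaryCentralizerGroup A k ≤ unitaryCentralizerGroup A k' := by
    intro k k' hk hknd hk' hk'nd u hu
    obtain ⟨B, -, hBnd, lam, -, hB⟩ := exists_bilinForm_isAlt_nondegenerate (A := A) hknd
    obtain ⟨B', -, -, lam', hlam', hB'⟩ := exists_bilinForm_isAlt_nondegenerate (A := A) hk'nd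
    obtain ⟨a, ha⟩ := exists_forall_bilin_apply_eq hBnd B'
    have haE := mem_bicommutant_of_forall_bilin_apply_eq hBnd (bilinForm_hodgeInvariant hk hB)
      (bilinForm_hodgeInvariant hk' hB') ha
    -- `u ∈ C(A)^×` commutes with `a ∈ E'' = C(C(A))`
    have hua : ∀ x, u (a x) = a (u x) := fun x ↦ by
      have hu1 : ((u : complexBetti A.X 1 →ₗ[ℂ] complexBetti A.X 1) : Module.End ℂ (complexBetti A.X 1)) ∈
          centralizerAlgebra A := Milne1999.mem_centralizerGroup_iff_coe_mem.1 hu.1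
      have e := LinearMap.congr_fun ((Subalgebra.mem_centralizer_iff ℂ).1 haE _ hu1) x
      simpa only [Module.End.mul_apply, LinearEquiv.coe_coe] using e
    have huB : ∀ x y, B (u x) (u y) = B x y := fun x y ↦ by rw [hB, hB, hu.2]
    refine ⟨hu.1, fun x y ↦ hlam' ?_⟩
    rw [← hB', ← hB', ← ha, ← hua, huB, ha]
  exact le_antisymm (incl hh hnd hh' hnd') (incl hh' hnd' hh hnd)

/-- **For polarization classes** (`dim A ≥ 1`; `h`, `h′` rational of type `(1,1)` with hard Lefschetz):
`unitaryCentralizerGroup A h = unitaryCentralizerGroup A h′`, without positivity. [cite: Milne1999LefschetzClasses, §1 pp. 643–644] -/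
theorem unitaryCentralizerGroup_eq_of_isPolarization' (h1 : 1 ≤ A.dim) (hQ : IsRationalClass h)
    (h11 : IsOfHodgeType A.dim A.X 2 1 1 h) (hHL : HasHardLefschetzProperty h A.dim) (hQ' : IsRationalClass h')
    (h11' : IsOfHodgeType A.dim A.X 2 1 1 h') (hHL' : HasHardLefschetzProperty h' A.dim) :
    unitaryCentralizerGroup A h = unitaryCentralizerGroup A h' :=
  unitaryCentralizerGroup_eq_of_mem_hodgeClassSpan (mem_hodgeClassSpan_of_isRationalClass'' hQ h11)
    (fun _ hx ↦ Milne1999.eq_zero_of_forall_polarizationPairingOne_eq_zero_of_hasHardLefschetzProperty h1 hHL hx)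
    (mem_hodgeClassSpan_of_isRationalClass'' hQ' h11')
    (fun _ hx ↦ Milne1999.eq_zero_of_forall_polarizationPairingOne_eq_zero_of_hasHardLefschetzProperty h1 hHL' hx)

end Milne

end Literature.AlgebraicGeometry.HodgeTheory

end
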